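import Literature.NumberTheory.LFunctions.ZetaClassicalRegionBounds
import HarnessLib

/-!
# An explicit (crude) de la Vallée Poussin zero-free region for `ζ` at large height

Topic `Literature/NumberTheory/LFunctions`. Everything in this file is PROVED.

`ZetaZeroFreeRegion.lean` proves de la Vallée Poussin's region `σ ≥ 1 − c/log|t|` (rh.S09,
`Literature.NumberTheory.LFunctions.zero_free_region_classical_holds`) with SOME absolute `c > 0`, by
specialising the abstract Landau–Montgomery–Vaughan argument `ClassicalZFRData.zeroFree`
(Montgomery–Vaughan, *Multiplicative Number Theory I*, Theorem 6.6) to `ζ`. That constant is not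
accessible (it passes through compactness arguments near the pole `s = 1`). This file runs the
SAME argument once more for `ζ` at heights `|t| ≥ T ≥ 5` only, where the pole plays no role, with
every constant made explicit:

* `Literature.NumberTheory.LFunctions.ZetaExplicitZFR.key_inequality` — for `|t| ≥ 5`,
  `0 < δ ≤ 3/64` and a zero `β + it` of `ζ` with `β ≥ 1 − 7/64`:
  `4/(1 + δ − β) ≤ 3/δ + 320 log|t| + 5298`
  (Montgomery–Vaughan (6.4)–(6.9): the `3-4-1` inequality for `−ζ'/ζ`, and Titchmarsh's Lemma α —
  in the tree with the explicit constant `8`, `Literature.Analysis.Complex.titchmarsh_logDeriv_sub_sum` —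
  on the discs `|s − (1 + 1/64 + it)| ≤ 1/8`, with `|ζ₁(s)| ≤ 3(|t| + 5)²` on the doubled discs
  (Titchmarsh (2.12.2), `norm_riemannZeta₁_le_of_re_pos`) and `|ζ₁(1 + 1/64 + it)| ≥ |t|/65`
  (`1/ζ = L(μ, s)`, `ZetaClassicalRegion.norm_riemannZeta_ge_of_one_lt_re`); here
  `ζ₁(s) = (s − 1)ζ(s)` is Mathlib's entire `riemannZeta₁`);
* `Literature.NumberTheory.LFunctions.riemannZeta_one_sub_re_ge_explicit` — **for `5 ≤ T ≤ |t|`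
  and `ζ(β + it) = 0`: `1 − β ≥ 1/((4480 + 74172/log T) log|t|)`** (the choice
  `δ = 1/(2E log|t|)`, `E = 320 + 5298/log T`, as in Montgomery–Vaughan's proof);
* `Literature.NumberTheory.LFunctions.riemannZeta_one_sub_re_ge_of_exp_le` — the instance used by
  the Vinogradov–Korobov strand: for `t ≥ exp 998`, `1 − β ≥ 1/(4555 log t)`.

The constants are hopeless compared with the explicit literature (`1/(5.558691 log|t|)`,
Mossinghoff–Trudgian–Yang 2024, Theorem 1.3, a named fact in the tree resting on the numerical
verification of RH to height `3·10¹²`); the point of this file is that a PROVED explicit region of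
the shape `c/log|t|`, however poor, is all that "extremal counterexample" arguments need as their
a-priori input (e.g. the descent of `VinogradovKorobovIntermediate.lean`), and this removes the
explicit Theorem 1.3 from the hypotheses of such arguments.

## References

* H. L. Montgomery, R. C. Vaughan, *Multiplicative Number Theory I. Classical Theory*, CUP 2007,
  §6.1, Lemma 6.5, Theorem 6.6 and its proof ((6.4)–(6.9)). [cite: MontgomeryVaughan2007]
* E. C. Titchmarsh, *The Theory of the Riemann Zeta-Function*, 2nd ed. (1986), §2.12 (2.12.2),
  §3.9 Lemma α. [cite: Titchmarsh1986]
-/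

noncomputable section

open Complex Metric Set

namespace Literature.NumberTheory.LFunctions

namespace ZetaExplicitZFR

/-! ## Numerical constants -/

/-- `exp 1 ≥ 2.718`. [folklore] -/
theorem exp_one_ge : (2.718 : ℝ) ≤ Real.exp 1 := by
  have := Real.exp_one_gt_d9; linarith

/-- `log 780 ≤ 7` (`2.718⁷ > 780`). [folklore] -/
theorem log_780_le : Real.log 780 ≤ 7 := by
  rw [Real.log_le_iff_le_exp (by norm_num)]
  have h : (2.718 : ℝ) ^ 7 ≤ Real.exp 1 ^ 7 := pow_le_pow_left₀ (by norm_num) exp_one_ge 7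
  have e := Real.exp_one_pow 7
  push_cast at e
  rw [← e]
  exact le_trans (by norm_num) h

/-- `log 312000 ≤ 13` (`2.718¹³ > 312000`). [folklore] -/
theorem log_312000_le : Real.log 312000 ≤ 13 := by
  rw [Real.log_le_iff_le_exp (by norm_num)]
  have h : (2.718 : ℝ) ^ 13 ≤ Real.exp 1 ^ 13 := pow_le_pow_left₀ (by norm_num) exp_one_ge 13
  have e := Real.exp_one_pow 13
  push_cast at e
  rw [← e]
  exact le_trans (by norm_num) h

/-- `log 2 ≤ 0.7`. [folklore] -/
theorem log_two_le : Real.log 2 ≤ 0.7 := by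
  have := Real.log_two_lt_d9; linarith

/-! ## `ζ₁ = (s − 1)ζ(s)` on the discs `|s − (1 + 1/64 + it)| ≤ 1/4` -/

/-- The centres of the discs are `c(t) = 1 + 1/64 + it` (Montgomery–Vaughan's `1 + δ' + it` with
the fixed offset `η/32`, `η = 1/2`, of `ClassicalZFRData.exists_logDeriv_package`); real part.
[folklore] -/
theorem ctr_re (t : ℝ) : (1 + 1 / 64 + t * I : ℂ).re = 1 + 1 / 64 := by simp

/-- Imaginary part of the centre `c(t)`. [folklore] -/
theorem ctr_im (t : ℝ) : (1 + 1 / 64 + t * I : ℂ).im = t := by simp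

/-- Titchmarsh (2.12.2) in the strip: `‖ζ₁(z)‖ ≤ 3(|Im z| + 4)²` for `1/2 < Re z ≤ 3`
(from `‖ζ₁(z)‖ ≤ ‖z‖ + ‖z‖‖z − 1‖/Re z`). [cite: Titchmarsh1986, §2.12 eq. (2.12.2)] -/
theorem norm_riemannZeta₁_le_sq {z : ℂ} (h1 : 1 / 2 < z.re) (h2 : z.re ≤ 3) :
    ‖riemannZeta₁ z‖ ≤ 3 * (|z.im| + 4) ^ 2 := by
  have hσ : 0 < z.re := by linarith
  have hns : ‖z‖ ≤ |z.im| + 4 := by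
    have h1 := Complex.norm_le_abs_re_add_abs_im z
    have h2 : |z.re| ≤ 3 := abs_le.mpr ⟨by linarith, h2⟩
    linarith
  have hns1 : ‖z - 1‖ ≤ |z.im| + 4 := by
    have h1 := Complex.norm_le_abs_re_add_abs_im (z - 1)
    simp only [Complex.sub_re, Complex.one_re, Complex.sub_im, Complex.one_im, sub_zero] at h1
    have h2 : |z.re - 1| ≤ 3 := abs_le.mpr ⟨by linarith, by linarith⟩
    linarith
  have hmain := norm_riemannZeta₁_le_of_re_pos hσ
  have hdiv : ‖z‖ * ‖z - 1‖ / z.re ≤ 2 * ((|z.im| + 4) * (|z.im| + 4)) := by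
    rw [div_le_iff₀ hσ]
    have h12 : ‖z‖ * ‖z - 1‖ ≤ (|z.im| + 4) * (|z.im| + 4) :=
      mul_le_mul hns hns1 (norm_nonneg _) (by positivity)
    have : (1 : ℝ) ≤ 2 * z.re := by linarith
    nlinarith [h12, mul_nonneg (norm_nonneg z) (norm_nonneg (z - 1))]
  calc ‖riemannZeta₁ z‖ ≤ ‖z‖ + ‖z‖ * ‖z - 1‖ / z.re := hmain
    _ ≤ (|z.im| + 4) + 2 * ((|z.im| + 4) * (|z.im| + 4)) := add_le_add hns hdiv
    _ ≤ 3 * (|z.im| + 4) ^ 2 := by nlinarith [abs_nonneg z.im]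

/-- On the doubled disc `|z − c(t)| ≤ 1/4`: `‖ζ₁(z)‖ ≤ 3(|t| + 5)²`. [folklore] -/
theorem norm_riemannZeta₁_le_on_disc (t : ℝ) {z : ℂ} (hz : z ∈ closedBall (1 + 1 / 64 + t * I : ℂ) (2 * (1 / 8))) :
    ‖riemannZeta₁ z‖ ≤ 3 * (|t| + 5) ^ 2 := by
  rw [mem_closedBall_iff_norm] at hz
  have hre := abs_re_le_norm (z - (1 + 1 / 64 + t * I : ℂ))
  have him := abs_im_le_norm (z - (1 + 1 / 64 + t * I : ℂ))
  rw [Complex.sub_re, ctr_re] at hre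
  rw [Complex.sub_im, ctr_im] at him
  have h1 : 1 / 2 < z.re := by
    have := neg_abs_le (z.re - (1 + 1 / 64)); linarith
  have h2 : z.re ≤ 3 := by
    have := le_abs_self (z.re - (1 + 1 / 64)); linarith
  refine (norm_riemannZeta₁_le_sq h1 h2).trans ?_
  have h3 : |z.im| + 4 ≤ |t| + 5 := by
    have := abs_sub_abs_le_abs_sub z.im t; linarith
  have h4 : 0 ≤ |z.im| + 4 := by positivity
  nlinarith [mul_le_mul h3 h3 h4 (by positivity)]

/-- At the centre: `‖ζ₁(c(t))‖ ≥ ‖c(t) − 1‖/65` (`‖ζ(s)‖ ≥ (σ − 1)/σ = 1/65` at `σ = 1 + 1/64`).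
[folklore] -/
theorem norm_riemannZeta₁_ctr_ge (t : ℝ) :
    ‖(1 + 1 / 64 + t * I : ℂ) - 1‖ / 65 ≤ ‖riemannZeta₁ (1 + 1 / 64 + t * I : ℂ)‖ := by
  have hc1 : (1 + 1 / 64 + t * I : ℂ) ≠ 1 := by
    intro h; have := congrArg Complex.re h; norm_num at this
  have hre : 1 < (1 + 1 / 64 + t * I : ℂ).re := by rw [ctr_re]; norm_num
  rw [riemannZeta₁_eq_mul hc1, norm_mul]
  have h := ZetaClassicalRegion.norm_riemannZeta_ge_of_one_lt_re hre
  rw [ctr_re] at h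
  have e : ((1 : ℝ) + 1 / 64 - 1) / (1 + 1 / 64) = 1 / 65 := by norm_num
  rw [e] at h
  have h0 : 0 ≤ ‖(1 + 1 / 64 + t * I : ℂ) - 1‖ := norm_nonneg _
  calc ‖(1 + 1 / 64 + t * I : ℂ) - 1‖ / 65 = ‖(1 + 1 / 64 + t * I : ℂ) - 1‖ * (1 / 65) := by ring
    _ ≤ ‖(1 + 1 / 64 + t * I : ℂ) - 1‖ * ‖riemannZeta (1 + 1 / 64 + t * I : ℂ)‖ := mul_le_mul_of_nonneg_left h h0

/-- `‖ζ₁(c(t))‖ ≥ |t|/65`. [folklore] -/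
theorem norm_riemannZeta₁_ctr_ge_abs (t : ℝ) : |t| / 65 ≤ ‖riemannZeta₁ (1 + 1 / 64 + t * I : ℂ)‖ := by
  refine le_trans ?_ (norm_riemannZeta₁_ctr_ge t)
  have := abs_im_le_norm ((1 + 1 / 64 + t * I : ℂ) - 1)
  simp only [Complex.sub_im, ctr_im, Complex.one_im, sub_zero] at this
  linarith

/-- `‖ζ₁(c(0))‖ ≥ 1/4160` (`‖c(0) − 1‖ = 1/64`). [folklore] -/
theorem norm_riemannZeta₁_ctr_zero_ge :
    (1 : ℝ) / 4160 ≤ ‖riemannZeta₁ (1 + 1 / 64 + (0 : ℝ) * I : ℂ)‖ := by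
  refine le_trans ?_ (norm_riemannZeta₁_ctr_ge 0)
  have := abs_re_le_norm ((1 + 1 / 64 + (0 : ℝ) * I : ℂ) - 1)
  simp only [Complex.sub_re, ctr_re, Complex.one_re] at this
  rw [show (1 : ℝ) + 1 / 64 - 1 = 1 / 64 by norm_num, abs_of_pos (by norm_num)] at this
  linarith

/-- `ζ₁ ≠ 0` at the centres. [folklore] -/
theorem riemannZeta₁_ctr_ne_zero (t : ℝ) : riemannZeta₁ (1 + 1 / 64 + t * I : ℂ) ≠ 0 :=
  ZetaOneLine.riemannZeta₁_ne_zero_of_one_le_re (by rw [ctr_re]; norm_num)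

/-! ## Titchmarsh's Lemma α on the discs, with explicit constants -/

/-- **Lemma α for `ζ₁` on `|s − c(t)| ≤ 1/8` (Montgomery–Vaughan Lemma 6.4, explicit).** If
`log(3(|t| + 5)²/‖ζ₁(c(t))‖) + 1 ≤ Q`, then with `S` the zeros of `ζ₁` in `|a − c(t)| ≤ 1/8`
(multiplicities `m ≥ 1`): `ζ₁'/ζ₁(z) = ∑_{a ∈ S} m(a)/(z − a) + ψ(z)` on `|z − c(t)| < 1/8`
(`ζ₁(z) ≠ 0`), with `‖ψ(z)‖ ≤ 64 Q` for `|z − c(t)| ≤ 1/32`.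
[cite: MontgomeryVaughan2007, Lemma 6.4] [cite: Titchmarsh1986, §3.9 Lemma α] -/
theorem logDeriv_package (t : ℝ) {Q : ℝ}
    (hQ : Real.log (3 * (|t| + 5) ^ 2 / ‖riemannZeta₁ (1 + 1 / 64 + t * I : ℂ)‖) + 1 ≤ Q) :
    ∃ (S : Finset ℂ) (m : ℂ → ℕ) (ψ : ℂ → ℂ),
      (∀ a ∈ S, riemannZeta₁ a = 0 ∧ 0 < m a ∧ ‖a - (1 + 1 / 64 + t * I : ℂ)‖ ≤ 1 / 8) ∧
      (∀ a, riemannZeta₁ a = 0 → ‖a - (1 + 1 / 64 + t * I : ℂ)‖ ≤ 1 / 8 → a ∈ S) ∧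
      (∀ z ∈ ball (1 + 1 / 64 + t * I : ℂ) (1 / 8), riemannZeta₁ z ≠ 0 →
        ψ z = deriv riemannZeta₁ z / riemannZeta₁ z - ∑ a ∈ S, (m a : ℂ) / (z - a)) ∧
      (∀ z ∈ closedBall (1 + 1 / 64 + t * I : ℂ) (1 / 32), ‖ψ z‖ ≤ 64 * Q) := by
  obtain ⟨S, m, ψ, hS, hS', -, hψ, hψb, -⟩ :=
    Literature.Analysis.Complex.titchmarsh_logDeriv_sub_sum differentiable_riemannZeta₁
      (riemannZeta₁_ctr_ne_zero t) (R := 1 / 8) (M := 3 * (|t| + 5) ^ 2) (by norm_num)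
      (fun z hz ↦ norm_riemannZeta₁_le_on_disc t hz)
  refine ⟨S, m, ψ, hS, hS', hψ, fun z hz ↦ ?_⟩
  have hz' : z ∈ closedBall (1 + 1 / 64 + t * I : ℂ) (1 / 8 / 4) := by convert hz using 2; norm_num
  refine (hψb z hz').trans ?_
  rw [show (8 : ℝ) * (Real.log (3 * (|t| + 5) ^ 2 / ‖riemannZeta₁ (1 + 1 / 64 + t * I : ℂ)‖) + 1) / (1 / 8)
      = 64 * (Real.log (3 * (|t| + 5) ^ 2 / ‖riemannZeta₁ (1 + 1 / 64 + t * I : ℂ)‖) + 1) by ring]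
  exact mul_le_mul_of_nonneg_left hQ (by norm_num)

/-- The size of the package constant at height `|t| ≥ 5`: `log(3(|t|+5)²/‖ζ₁(c(t))‖) + 1 ≤
log|t| + 8` (as `3(|t|+5)² · 65/|t| ≤ 780|t|` and `log 780 ≤ 7`). [folklore] -/
theorem package_const_le {t : ℝ} (ht : 5 ≤ |t|) :
    Real.log (3 * (|t| + 5) ^ 2 / ‖riemannZeta₁ (1 + 1 / 64 + t * I : ℂ)‖) + 1 ≤ Real.log |t| + 8 := by
  have h0 : 0 < |t| := by linarith
  have hlow := norm_riemannZeta₁_ctr_ge_abs t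
  have hpos : 0 < ‖riemannZeta₁ (1 + 1 / 64 + t * I : ℂ)‖ := lt_of_lt_of_le (by positivity) hlow
  have h1 : 3 * (|t| + 5) ^ 2 / ‖riemannZeta₁ (1 + 1 / 64 + t * I : ℂ)‖ ≤ 780 * |t| := by
    rw [div_le_iff₀ hpos]
    have h2 : (|t| + 5) ^ 2 ≤ 4 * |t| ^ 2 := by nlinarith
    calc 3 * (|t| + 5) ^ 2 ≤ 3 * (4 * |t| ^ 2) := by linarith
      _ = 780 * |t| * (|t| / 65) := by ring
      _ ≤ 780 * |t| * ‖riemannZeta₁ (1 + 1 / 64 + t * I : ℂ)‖ := mul_le_mul_of_nonneg_left hlow (by positivity)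
  have h3 : Real.log (3 * (|t| + 5) ^ 2 / ‖riemannZeta₁ (1 + 1 / 64 + t * I : ℂ)‖) ≤ Real.log (780 * |t|) :=
    Real.log_le_log (by positivity) h1
  rw [Real.log_mul (by norm_num) h0.ne'] at h3
  linarith [log_780_le]

/-- The package constant at height `0`: `log(75/‖ζ₁(c(0))‖) + 1 ≤ 14` (`75 · 4160 = 312000`,
`log 312000 ≤ 13`). [folklore] -/
theorem package_const_zero_le :
    Real.log (3 * (|(0 : ℝ)| + 5) ^ 2 / ‖riemannZeta₁ (1 + 1 / 64 + (0 : ℝ) * I : ℂ)‖) + 1 ≤ 14 := by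
  have hlow := norm_riemannZeta₁_ctr_zero_ge
  have hpos : 0 < ‖riemannZeta₁ (1 + 1 / 64 + (0 : ℝ) * I : ℂ)‖ := lt_of_lt_of_le (by norm_num) hlow
  have h1 : 3 * (|(0 : ℝ)| + 5) ^ 2 / ‖riemannZeta₁ (1 + 1 / 64 + (0 : ℝ) * I : ℂ)‖ ≤ 312000 := by
    rw [abs_zero, div_le_iff₀ hpos]
    have e : (3 : ℝ) * (0 + 5) ^ 2 = 75 := by norm_num
    rw [e]; linarith
  have h3 := Real.log_le_log (by rw [abs_zero]; positivity) h1
  linarith [log_312000_le]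

/-- **Real parts at `s₀ = 1 + δ + it`, `0 < δ ≤ 3/64` (Montgomery–Vaughan (6.5), explicit).** With
`Q` as in `logDeriv_package`: `−Re ζ₁'/ζ₁(s₀) ≤ 64Q`, and `−Re ζ₁'/ζ₁(s₀) ≤ 64Q − 1/(1 + δ − β)`
if moreover `ζ₁(β + it) = 0` with `β ≥ 1 − 7/64` (every zero `a` of `ζ₁` has `Re a < 1 < Re s₀`,
so each `Re m(a)/(s₀ − a) ≥ 0`). [cite: MontgomeryVaughan2007, Theorem 6.6 (proof, (6.5))] -/
theorem neg_re_logDeriv_le (t : ℝ) {Q δ : ℝ}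
    (hQ : Real.log (3 * (|t| + 5) ^ 2 / ‖riemannZeta₁ (1 + 1 / 64 + t * I : ℂ)‖) + 1 ≤ Q)
    (hδ : 0 < δ) (hδ' : δ ≤ 3 / 64) :
    -(deriv riemannZeta₁ (1 + δ + t * I) / riemannZeta₁ (1 + δ + t * I)).re ≤ 64 * Q ∧
    ∀ β : ℝ, 1 - 7 / 64 ≤ β → riemannZeta₁ (β + t * I) = 0 →
      -(deriv riemannZeta₁ (1 + δ + t * I) / riemannZeta₁ (1 + δ + t * I)).re
        ≤ 64 * Q - 1 / (1 + δ - β) := by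
  obtain ⟨S, m, ψ, hS, hS', hψ, hψb⟩ := logDeriv_package t hQ
  set s₀ : ℂ := 1 + δ + t * I with hs₀
  have hs₀re : s₀.re = 1 + δ := by simp [hs₀]
  have hs₀c : s₀ - (1 + 1 / 64 + t * I : ℂ) = ((δ - 1 / 64 : ℝ) : ℂ) := by
    simp only [hs₀]; push_cast; ring
  have hnorm : ‖s₀ - (1 + 1 / 64 + t * I : ℂ)‖ ≤ 1 / 32 := by
    rw [hs₀c, Complex.norm_real, Real.norm_eq_abs, abs_le]; constructor <;> linarith
  have hball : s₀ ∈ ball (1 + 1 / 64 + t * I : ℂ) (1 / 8) := mem_ball_iff_norm.2 (by linarith)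
  have hcl : s₀ ∈ closedBall (1 + 1 / 64 + t * I : ℂ) (1 / 32) := mem_closedBall_iff_norm.2 hnorm
  have hne : riemannZeta₁ s₀ ≠ 0 :=
    ZetaOneLine.riemannZeta₁_ne_zero_of_one_le_re (by rw [hs₀re]; linarith)
  have hEq : deriv riemannZeta₁ s₀ / riemannZeta₁ s₀ = ψ s₀ + ∑ a ∈ S, (m a : ℂ) / (s₀ - a) := by
    rw [hψ s₀ hball hne]; ring
  have hSre : ∀ a ∈ S, a.re < s₀.re := by
    intro a ha
    have hza := (hS a ha).1
    have : a.re < 1 := by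
      by_contra hcon
      exact ZetaOneLine.riemannZeta₁_ne_zero_of_one_le_re (not_lt.1 hcon) hza
    rw [hs₀re]; linarith
  obtain ⟨hnn, hge⟩ := ClassicalZFRData.re_sum_div_ge (m := m) hSre
  have hψre : -(ψ s₀).re ≤ 64 * Q := by
    have := (abs_re_le_norm (ψ s₀)).trans (hψb s₀ hcl)
    linarith [neg_abs_le (ψ s₀).re]
  refine ⟨?_, fun β hβ hz ↦ ?_⟩
  · rw [hEq, Complex.add_re]; linarith
  · set ρ : ℂ := β + t * I with hρ
    have hβ1 : β < 1 := by
      by_contra hcon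
      exact ZetaOneLine.riemannZeta₁_ne_zero_of_one_le_re (s := ρ) (by simp [hρ]; linarith) hz
    have hρS : ρ ∈ S := by
      refine hS' ρ hz ?_
      have : ρ - (1 + 1 / 64 + t * I : ℂ) = ((β - 1 - 1 / 64 : ℝ) : ℂ) := by simp only [hρ]; push_cast; ring
      rw [this, Complex.norm_real, Real.norm_eq_abs, abs_le]
      constructor <;> linarith
    have hρterm : ((s₀ - ρ)⁻¹).re = 1 / (1 + δ - β) := by
      have : s₀ - ρ = ((1 + δ - β : ℝ) : ℂ) := by simp only [hs₀, hρ]; push_cast; ring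
      rw [this, ← Complex.ofReal_inv, Complex.ofReal_re, one_div]
    have hsum_ge := hge ρ hρS (hS ρ hρS).2.1
    rw [hρterm] at hsum_ge
    rw [hEq, Complex.add_re]
    linarith

/-- `Re L(s) = Re 1/(s − 1) − Re ζ₁'/ζ₁(s)` for `σ > 1`, `L(s) = ∑ Λ(n) n^{-s} = −ζ'/ζ(s)`.
[cite: MontgomeryVaughan2007, §6.1 (proof of Theorem 6.6)] -/
theorem re_LSeries_vonMangoldt_eq {s : ℂ} (hs : 1 < s.re) :
    (LSeries (fun n ↦ (ArithmeticFunction.vonMangoldt n : ℂ)) s).re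
      = (1 / (s - 1)).re - (deriv riemannZeta₁ s / riemannZeta₁ s).re := by
  have h := deriv_riemannZeta₁_div_eq hs
  have : LSeries (fun n ↦ (ArithmeticFunction.vonMangoldt n : ℂ)) s
      = 1 / (s - 1) - deriv riemannZeta₁ s / riemannZeta₁ s := by rw [h]; ring
  rw [this, Complex.sub_re]

/-- **The key inequality, explicit** (Montgomery–Vaughan, proof of Theorem 6.6, before the choice
of `δ`): for `|t| ≥ 5`, `0 < δ ≤ 3/64` and a zero `β + it` of `ζ` with `β ≥ 1 − 7/64`,
`4/(1 + δ − β) ≤ 3/δ + 320 log|t| + 5298`. Ingredients: `3-4-1` (MV Lemma 6.5) at `σ₀ = 1 + δ`;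
`Re L(σ₀) ≤ 1/δ + 896` (Lemma α at height `0`, `Q = 14`); `Re L(σ₀ + it) ≤ 1 + 64(log|t| + 8) −
1/(1 + δ − β)` and `Re L(σ₀ + 2it) ≤ 1 + 64(log|t| + 8.7)` (Lemma α at heights `t`, `2t`;
`Re 1/(σ₀ − 1 + iu) ≤ 1` for `|u| ≥ 1`). [cite: MontgomeryVaughan2007, Theorem 6.6 (proof)] -/
theorem key_inequality {t δ β : ℝ} (ht : 5 ≤ |t|) (hδ : 0 < δ) (hδ' : δ ≤ 3 / 64)
    (hβ : 1 - 7 / 64 ≤ β) (hz : riemannZeta (β + t * I) = 0) :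
    4 / (1 + δ - β) ≤ 3 / δ + 320 * Real.log |t| + 5298 := by
  set L : ℂ → ℂ := LSeries (fun n ↦ (ArithmeticFunction.vonMangoldt n : ℂ)) with hL
  have hdata := classicalZFRData_riemannZeta
  set σ₀ : ℝ := 1 + δ with hσ₀
  have hσ₀1 : 1 < σ₀ := by rw [hσ₀]; linarith
  have hδ1 : δ ≤ 1 := by linarith
  have ht0 : t ≠ 0 := by intro h; rw [h, abs_zero] at ht; linarith
  have hℓ0 : 0 < Real.log |t| := Real.log_pos (by linarith)
  -- the zero as a zero of `ζ₁`
  have hρ1 : (β + t * I : ℂ) ≠ 1 := by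
    intro h; have := congrArg Complex.im h; simp at this; exact ht0 this
  have hz₁ : riemannZeta₁ (β + t * I) = 0 := (riemannZeta₁_eq_zero_iff hρ1).2 hz
  -- (a) 3-4-1
  have h341 := ClassicalZFRData.three_four_one hdata.nonneg hdata.summable hσ₀1 t
  -- (b) the real point: `Re L(σ₀) ≤ 1/δ + 896`
  have hb : (L σ₀).re ≤ 1 / δ + 896 := by
    have h1 := re_LSeries_vonMangoldt_eq (s := (σ₀ : ℂ)) (by simp [hσ₀1])
    have h2 := (neg_re_logDeriv_le 0 package_const_zero_le hδ hδ').1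
    have e1 : (1 : ℂ) + δ + ((0 : ℝ) : ℂ) * I = (σ₀ : ℂ) := by rw [hσ₀]; push_cast; ring
    rw [e1] at h2
    have e2 : (1 / ((σ₀ : ℂ) - 1)).re = 1 / δ := by
      rw [show (σ₀ : ℂ) - 1 = ((σ₀ - 1 : ℝ) : ℂ) by push_cast; ring, ← Complex.ofReal_one,
        ← Complex.ofReal_div, Complex.ofReal_re, hσ₀]
      ring
    rw [hL, h1, e2]
    linarith
  -- (c) the point `σ₀ + it`
  have hc : (L (σ₀ + t * I)).re ≤ 1 + 64 * (Real.log |t| + 8) - 1 / (1 + δ - β) := by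
    have h1 := re_LSeries_vonMangoldt_eq (s := (σ₀ : ℂ) + t * I) (by simp [hσ₀1])
    have h2 := (neg_re_logDeriv_le t (package_const_le ht) hδ hδ').2 β hβ hz₁
    have e1 : (1 : ℂ) + δ + t * I = (σ₀ : ℂ) + t * I := by rw [hσ₀]; push_cast; ring
    rw [e1] at h2
    have e2 : (1 / ((σ₀ : ℂ) + t * I - 1)).re ≤ 1 := by
      have : (σ₀ : ℂ) + t * I - 1 = δ + t * I := by rw [hσ₀]; push_cast; ring
      rw [one_div, this]
      have := ClassicalZFRData.re_inv_le_of_le_abs (u := t) hδ hδ1 (show (0 : ℝ) < 2 by norm_num)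
        (by linarith)
      linarith [show (4 : ℝ) / 2 ^ 2 = 1 by norm_num]
    rw [hL, h1]
    linarith
  -- (d) the point `σ₀ + 2it`
  have hd : (L (σ₀ + (2 * t) * I)).re ≤ 1 + 64 * (Real.log |t| + 8.7) := by
    have h1 := re_LSeries_vonMangoldt_eq (s := (σ₀ : ℂ) + (2 * t) * I) (by simp [hσ₀1])
    have ht2 : 5 ≤ |2 * t| := by rw [abs_mul, abs_two]; linarith [abs_nonneg t]
    have h2 := (neg_re_logDeriv_le (2 * t) (package_const_le ht2) hδ hδ').1
    have e1 : (1 : ℂ) + δ + ((2 * t : ℝ) : ℂ) * I = (σ₀ : ℂ) + (2 * t) * I := by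
      rw [hσ₀]; push_cast; ring
    rw [e1] at h2
    have e2 : (1 / ((σ₀ : ℂ) + (2 * t) * I - 1)).re ≤ 1 := by
      have : (σ₀ : ℂ) + (2 * t) * I - 1 = δ + ((2 * t : ℝ) : ℂ) * I := by
        rw [hσ₀]; push_cast; ring
      rw [one_div, this]
      have := ClassicalZFRData.re_inv_le_of_le_abs (u := 2 * t) hδ hδ1
        (show (0 : ℝ) < 2 by norm_num) (by linarith)
      linarith [show (4 : ℝ) / 2 ^ 2 = 1 by norm_num]
    have hlog2 : Real.log |2 * t| ≤ Real.log |t| + 0.7 := by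
      rw [abs_mul, abs_two, Real.log_mul (by norm_num) (by positivity)]
      linarith [log_two_le]
    rw [hL, h1]
    linarith
  -- (e) combine
  have hpos : 0 < 1 + δ - β := by
    have : β < 1 := by
      by_contra hcon
      exact riemannZeta_ne_zero_of_one_le_re (s := β + t * I) (by simp; linarith) hz
    linarith
  change 0 ≤ 3 * (L ↑σ₀).re + 4 * (L (↑σ₀ + ↑t * I)).re + (L (↑σ₀ + 2 * ↑t * I)).re at h341
  linear_combination 3 * hb + 4 * hc + hd + h341

end ZetaExplicitZFR

open ZetaExplicitZFR in
/-- **An explicit de la Vallée Poussin region for `ζ` at height `≥ T ≥ 5`.** If `5 ≤ T ≤ |t|` and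
`ζ(β + it) = 0` then `1 − β ≥ 1/((4480 + 74172/log T) · log|t|)`. (Montgomery–Vaughan's proof of
Theorem 6.6 with explicit constants: `ZetaExplicitZFR.key_inequality` with `δ = 1/(2E log|t|)`,
`E = 320 + 5298/log T`, gives `1 + δ − β ≥ 4/(7E log|t|)`; zeros with `β < 1 − 7/64` satisfy the
bound trivially.) The constant is crude (`≈ 1/4555` for `T = e^998`, against the `1/5.558691` of
Mossinghoff–Trudgian–Yang 2024); its purpose is to serve as a PROVED a-priori input.
[cite: MontgomeryVaughan2007, Theorem 6.6] -/
theorem riemannZeta_one_sub_re_ge_explicit {T β t : ℝ} (hT : 5 ≤ T) (ht : T ≤ |t|)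
    (hz : riemannZeta (β + t * I) = 0) :
    1 / ((4480 + 74172 / Real.log T) * Real.log |t|) ≤ 1 - β := by
  have hT0 : 0 < T := by linarith
  have hlogT : 1 ≤ Real.log T := by
    rw [Real.le_log_iff_exp_le hT0]
    have := Real.exp_one_lt_d9; linarith
  have hlogT0 : 0 < Real.log T := by linarith
  set ℓ : ℝ := Real.log |t| with hℓ
  have hℓT : Real.log T ≤ ℓ := Real.log_le_log hT0 ht
  have hℓ2 : 1 ≤ ℓ := hlogT.trans hℓT
  set E : ℝ := 320 + 5298 / Real.log T with hE
  have hE0 : (0 : ℝ) ≤ 5298 / Real.log T := by positivity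
  have hE320 : 320 ≤ E := by rw [hE]; linarith
  have hEpos : 0 < E := by linarith
  have h14 : (4480 + 74172 / Real.log T) = 14 * E := by rw [hE]; ring
  rw [h14]
  have hEℓ : 0 < 14 * E * ℓ := by positivity
  -- `E ℓ ≥ 320 ℓ + 5298`
  have hEℓge : 320 * ℓ + 5298 ≤ E * ℓ := by
    have h1 : 5298 ≤ 5298 / Real.log T * ℓ := by
      rw [div_mul_eq_mul_div, le_div_iff₀ hlogT0]
      exact mul_le_mul_of_nonneg_left hℓT (by norm_num)
    rw [hE]; nlinarith
  -- `β < 1`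
  have hβ1 : β < 1 := by
    by_contra hcon
    exact riemannZeta_ne_zero_of_one_le_re (s := β + t * I) (by simp; linarith) hz
  rcases lt_or_ge β (1 - 7 / 64) with hβ | hβ
  · -- far from the line: trivial
    have h1 : 1 / (14 * E * ℓ) ≤ 1 / (14 * 320 * 1) := by
      apply one_div_le_one_div_of_le (by norm_num)
      have := mul_le_mul hE320 hℓ2 (by norm_num) hEpos.le
      linarith
    linarith [show (1 : ℝ) / (14 * 320 * 1) ≤ 7 / 64 by norm_num]
  · -- the 3-4-1 argument with `δ = 1/(2Eℓ)`
    set δ : ℝ := 1 / (2 * E * ℓ) with hδ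
    have hδpos : 0 < δ := by positivity
    have hδle : δ ≤ 3 / 64 := by
      rw [hδ, div_le_div_iff₀ (by positivity) (by norm_num)]
      have := mul_le_mul hE320 hℓ2 (by norm_num) hEpos.le
      linarith
    have ht5 : 5 ≤ |t| := hT.trans ht
    have hk := key_inequality ht5 hδpos hδle hβ hz
    have hpos : 0 < 1 + δ - β := by linarith
    -- `3/δ + 320ℓ + 5298 ≤ 7Eℓ`
    have h3δ : 3 / δ = 6 * E * ℓ := by rw [hδ]; field_simp; ring
    have hk' : 4 / (1 + δ - β) ≤ 7 * E * ℓ := by linarith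
    -- hence `1 + δ − β ≥ 4/(7Eℓ)`
    have hgap : 4 / (7 * E * ℓ) ≤ 1 + δ - β := by
      rw [div_le_iff₀ (by positivity)]
      rw [div_le_iff₀ hpos] at hk'
      linarith
    have e : 4 / (7 * E * ℓ) - δ = 1 / (14 * E * ℓ) := by rw [hδ]; field_simp; norm_num
    linarith

/-- The instance used by the Vinogradov–Korobov strand: **for `t ≥ exp 998` and `ζ(β + it) = 0`,
`1 − β ≥ 1/(4555 log t)`** (`T = exp 998` in `riemannZeta_one_sub_re_ge_explicit`:
`4480 + 74172/998 ≤ 4555`). [cite: MontgomeryVaughan2007, Theorem 6.6] -/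
theorem riemannZeta_one_sub_re_ge_of_exp_le {β t : ℝ} (ht : Real.exp 998 ≤ t)
    (hz : riemannZeta (β + t * I) = 0) : 1 / (4555 * Real.log t) ≤ 1 - β := by
  have ht0 : 0 < t := (Real.exp_pos _).trans_le ht
  have h5 : (5 : ℝ) ≤ Real.exp 998 := by linarith [Real.add_one_le_exp (998 : ℝ)]
  have habs : |t| = t := abs_of_pos ht0
  have h := riemannZeta_one_sub_re_ge_explicit h5 (by rw [habs]; exact ht) hz
  rw [Real.log_exp, habs] at h
  refine le_trans ?_ h
  have hlog : 998 ≤ Real.log t := by rw [Real.le_log_iff_exp_le ht0]; exact ht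
  have hlog0 : 0 < Real.log t := by linarith
  apply one_div_le_one_div_of_le (by positivity)
  apply mul_le_mul_of_nonneg_right _ hlog0.le
  norm_num

end Literature.NumberTheory.LFunctions
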